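import Summits.QuantumFields.BalabanUV.T4Continuum.Support.GramPerturbationLaw

/-!
# T⁴ programme, spine node NE2 (U1a) — THE COMPOSITE LAW: `AveragingLaws` for the composite of `k` ONE-STEP covariant averagings
# against the composite of the free ones ([Balaban1985BackgroundPropagators] (3.15) shape), from one-step transport errors and the
# two-level consistency of the averaged backgrounds (tier B of `t4/SKELETON-NE2-P1.md`, supplier row B3.e of the owner's table)

Tenth generation of the NE2 prover lineage P1 of the cell `pub-balaban`, file 3 (companion of file 1 `Support/GramPerturbationLaw`).
[Balaban1985BackgroundPropagators] p.393 (3.15): the covariant `j`-fold averaging is a COMPOSITE of one-step covariant averagings,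
«Q_j(U) = Q(Ū^{j−1})·…·Q(Ū)Q(U)», each step built on the background averaged to its own lattice.  The Gram law (file 1,
`perturbationLaws_gramCore`) needs, for the transport error `E_k = B̃_k − B_k` of the inner averaging, the size `ε` and the SANDWICHED two-level
pairings `δ_k` (`AveragingLaws D E J ε δ`).  This file derives them ABSTRACTLY from the composite structure — no contour geometry:

 * §1 bookkeeping: `Pfac ν θ m = ∏_{j<m}(1 + νθ^j) ≤ bexp ν θ = e^{ν/(1−θ)}` (`Real.add_one_le_exp`, the geometric sum), `AveragingLaws.mono`;
 * §2 composites: `Btow_succ'` (`B̃_{m+1} = B̃_m·(√r•Ã_m)`); the hypothesis SHAPE **`OneStepTransportLaws A At r ν θ cs`** on DATA — the level-`k` family of one-step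
   covariant averagings `At k j` (`j < k` used) has (i) one-step transport errors `‖√r•(At k j − A j)‖ ≤ ν·θ^j` (geometric in the LEVEL `j`: a one-step
   contour at spacing `L^{−j−1}` has physical length `O(L^{−j})`) and (ii) two-level consistency of the families `Σ_{j<k}‖√r•(At (k+1) j − At k j)‖ ≤ cs k`
   (the averaged backgrounds `Ū^{(j)}` of the levels `k+1` and `k` agree up to `cs k` — node NE3's currency); then **`opNorm_Btow_At_le`** `‖B̃^{(k)}_m‖ ≤ Pfac`,
   **`opNorm_Etow_le`** `‖B̃^{(k)}_m − B_m‖ ≤ bexp·ν·Σ_{j<m}θ^j`, **`opNorm_Dtow_le`** `‖B̃^{(k+1)}_m − B̃^{(k)}_m‖ ≤ Pfac_m·Σ_{j<m}‖√r•(At (k+1) j − At k j)‖`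
   (weighted induction);
 * §3 **`averagingLaws_composite`**: `FreeTowerLaws D A J F r e₀ e₁ f₀`, `‖D_k⁻¹‖ ≤ γ′`, `OneStepTransportLaws A At r ν θ cs` ⟹
   `AveragingLaws D (Ecomp A At r) J (epsComp ν θ) (deltaComp γ′ ν θ f₀ cs)` with `Ecomp A At r k = Btow (At k) r k − Btow A r k`,
   `epsComp = bexp·ν/(1−θ)`, `deltaComp k = (γ′ + f₀ k)·bexp·cs k + epsComp·f₀ k + bexp·γ′·ν·θ^k`, from the EXACT identity **`Ecomp_succ_mul_J_sub`**
   `E_{k+1}J_k − E_k = Δ_k + (Δ_k + E_k)F_k + B̃^{(k+1)}_k(√r•N_k)J_k` (`Δ_k = B̃^{(k+1)}_k − B̃^{(k)}_k`, `N_k = At (k+1) k − A k`);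
 * §4 **`perturbationLaws_compositeGram`**: with file 1, `PerturbationLaws D (gramCore (Btow A r) (Ecomp A At r)) J (ε(2+ε)γ′) (e2gram γ′ 1 ε e₀ e₁ f₀ δ)`,
   and `gramCore (Btow A r) (Ecomp A At r) k = B̃ᴴB̃ − BᴴB` (**`gramCore_composite_eq`**) — the `aQ_k(U)ᴴQ_k(U) − aQ_kᴴQ_k` summand of (3.26) for ANY tower whose
   covariant averaging is a composite of one-steps with the two laws above.

HONEST FRAMING (T4-DAG p. 1).  Abstract level families; averagings are DATA; (ii) is WHERE NE3 ENTERS (row B6) and is asserted by nobody; whether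
Bałaban's `Q_k(U_k(V))` is LITERALLY such a composite with backgrounds `Ū^{(j)}` common to adjacent levels up to `cs k` is the B0/B3.a reading, not
claimed here.  Finite index types, operator norm; rates / pairings / constants OURS; nothing printed is a hypothesis; no `def … : Prop` fact; NOT
infinite volume / mass gap / Clay / summit progress; spine 0/9 unchanged.  HONEST DEPENDENCY: continuum YM on T⁴ ⇐ BetaPertH ∧ nine spine estimates
(0/9 proved); BetaPertH ⇐ (D1) ∧ (D4) ∧ CAP+tail; G-an2-4 gates asym, D1 and NE2/3/4.  ABSOLUTE RULE kept; no `sorry`.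
-/

noncomputable section

open scoped BigOperators ComplexConjugate Matrix Matrix.Norms.L2Operator

namespace Summit.QuantumFields.BalabanUV.T4Continuum.CompositeAveragingLaw

open Summit.QuantumFields.BalabanUV.T4Continuum
open Summit.QuantumFields.BalabanUV.T4Continuum.CovariantAveragingTower (Atow Atow_succ Atow_zero opNorm_Atow_sq_le)
open Summit.QuantumFields.BalabanUV.T4Continuum.BackgroundResolventTower
open Summit.QuantumFields.BalabanUV.T4Continuum.GramPerturbationLaw

/-! ## §1 Bookkeeping: products `∏(1 + νθ^j)`, the exponential bound, monotonicity of `AveragingLaws` -/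

section Bookkeeping

/-- `∏_{j<m} (1 + ν·θ^j)`. [folklore] -/
def Pfac (ν θ : ℝ) (m : ℕ) : ℝ := ∏ j ∈ Finset.range m, (1 + ν * θ ^ j)

/-- `e^{ν/(1−θ)}`. [folklore] -/
def bexp (ν θ : ℝ) : ℝ := Real.exp (ν * (1 - θ)⁻¹)

/-- the finite geometric sum is at most `(1 − θ)⁻¹`. [folklore] -/
theorem geom_partial_le {θ : ℝ} (h0 : 0 ≤ θ) (h1 : θ < 1) (m : ℕ) : ∑ j ∈ Finset.range m, θ ^ j ≤ (1 - θ)⁻¹ := by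
  rw [Finset.range_eq_Ico]
  refine (geom_sum_Ico_le_of_lt_one h0 h1).trans (le_of_eq ?_)
  rw [pow_zero, one_div]

/-- `Pfac (m+1) = Pfac m · (1 + νθ^m)`. [folklore] -/
theorem Pfac_succ (ν θ : ℝ) (m : ℕ) : Pfac ν θ (m + 1) = Pfac ν θ m * (1 + ν * θ ^ m) := by
  rw [Pfac, Pfac, Finset.prod_range_succ]

/-- `1 ≤ Pfac`. [folklore] -/
theorem one_le_Pfac {ν θ : ℝ} (hν : 0 ≤ ν) (hθ : 0 ≤ θ) : ∀ m, 1 ≤ Pfac ν θ m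
  | 0 => by simp [Pfac]
  | m + 1 => by
    rw [Pfac_succ]
    have h1 : (1 : ℝ) ≤ 1 + ν * θ ^ m := le_add_of_nonneg_right (by positivity)
    nlinarith [one_le_Pfac hν hθ m]

/-- `Pfac` is non-decreasing. [folklore] -/
theorem Pfac_le_succ {ν θ : ℝ} (hν : 0 ≤ ν) (hθ : 0 ≤ θ) (m : ℕ) : Pfac ν θ m ≤ Pfac ν θ (m + 1) := by
  rw [Pfac_succ]
  have h0 : 0 ≤ Pfac ν θ m := zero_le_one.trans (one_le_Pfac hν hθ m)
  have h1 : (1 : ℝ) ≤ 1 + ν * θ ^ m := le_add_of_nonneg_right (by positivity)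
  nlinarith

/-- `Pfac m ≤ exp(ν·Σ_{j<m} θ^j)`. [folklore] -/
theorem Pfac_le_exp_sum {ν θ : ℝ} (hν : 0 ≤ ν) (hθ : 0 ≤ θ) :
    ∀ m, Pfac ν θ m ≤ Real.exp (ν * ∑ j ∈ Finset.range m, θ ^ j)
  | 0 => by simp [Pfac]
  | m + 1 => by
    rw [Pfac_succ, Finset.sum_range_succ, mul_add ν, Real.exp_add]
    have h1 : 1 + ν * θ ^ m ≤ Real.exp (ν * θ ^ m) := by rw [add_comm]; exact Real.add_one_le_exp _
    exact mul_le_mul (Pfac_le_exp_sum hν hθ m) h1 (by positivity) (Real.exp_pos _).le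

/-- `Pfac m ≤ bexp = e^{ν/(1−θ)}`. [folklore] -/
theorem Pfac_le_bexp {ν θ : ℝ} (hν : 0 ≤ ν) (hθ : 0 ≤ θ) (hθ1 : θ < 1) (m : ℕ) : Pfac ν θ m ≤ bexp ν θ :=
  (Pfac_le_exp_sum hν hθ m).trans (Real.exp_le_exp.mpr (mul_le_mul_of_nonneg_left (geom_partial_le hθ hθ1 m) hν))

/-- `0 < bexp`. [folklore] -/
theorem bexp_pos (ν θ : ℝ) : 0 < bexp ν θ := Real.exp_pos _

variable {ι : ℕ → Type*} [∀ k, Fintype (ι k)] [∀ k, DecidableEq (ι k)] {σ : Type*} [Fintype σ] [DecidableEq σ]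

/-- **monotonicity of `AveragingLaws`** in the size and the defects. [folklore] -/
theorem averagingLaws_mono {D : (k : ℕ) → Matrix (ι k) (ι k) ℂ} {X : (k : ℕ) → Matrix σ (ι k) ℂ} {J : (k : ℕ) → Matrix (ι (k + 1)) (ι k) ℂ}
    {x x' : ℝ} {g g' : ℕ → ℝ} (h : AveragingLaws D X J x g) (hx : x ≤ x') (hg : ∀ k, g k ≤ g' k) : AveragingLaws D X J x' g' where
  opNorm_le := fun k => (h.opNorm_le k).trans hx
  pair_mul_inv_le := fun k => (h.pair_mul_inv_le k).trans (hg k)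
  inv_mul_pair_le := fun k => (h.inv_mul_pair_le k).trans (hg k)

end Bookkeeping

/-! ## §2 Composites of one-step averagings: norms, transport error, level-to-level difference -/

section Composite

variable {ι : ℕ → Type*} [∀ k, Fintype (ι k)] [∀ k, DecidableEq (ι k)]
variable {A : (j : ℕ) → Matrix (ι j) (ι (j + 1)) ℂ} {At : ℕ → (j : ℕ) → Matrix (ι j) (ι (j + 1)) ℂ} {r ν θ : ℝ} {cs : ℕ → ℝ}

/-- `Btow X r (m+1) = Btow X r m · (√r•X_m)`. [folklore] -/
theorem Btow_succ' (hr : 0 < r) (X : (j : ℕ) → Matrix (ι j) (ι (j + 1)) ℂ) (m : ℕ) :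
    Btow X r (m + 1) = Btow X r m * ((((Real.sqrt r : ℝ) : ℂ)) • X m) := by
  have hsq : Real.sqrt (r ^ (m + 1)) = Real.sqrt (r ^ m) * Real.sqrt r := by
    rw [pow_succ, Real.sqrt_mul (pow_nonneg hr.le m)]
  rw [Btow, Btow, Atow_succ, hsq, Complex.ofReal_mul, mul_smul, Matrix.smul_mul, Matrix.mul_smul]

/-- **THE LAWS OF THE ONE-STEP COVARIANT AVERAGINGS** (hypothesis SHAPE on data): for every level `k` a family `At k j` of one-step averagings
(`j < k` used) with (i) one-step transport error `‖√r•(At k j − A j)‖ ≤ ν·θ^j`, `0 ≤ ν`, `0 ≤ θ < 1`, and (ii) two-level consistency of the families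
`Σ_{j<k} ‖√r•(At (k+1) j − At k j)‖ ≤ cs k`. [cite: Balaban1985BackgroundPropagators, (3.15) p.393 (shape: composite of one-steps)] [folklore] -/
structure OneStepTransportLaws (A : (j : ℕ) → Matrix (ι j) (ι (j + 1)) ℂ) (At : ℕ → (j : ℕ) → Matrix (ι j) (ι (j + 1)) ℂ) (r ν θ : ℝ)
    (cs : ℕ → ℝ) : Prop where
  /-- `0 ≤ ν`, `0 ≤ θ < 1` -/
  nonneg : 0 ≤ ν ∧ 0 ≤ θ ∧ θ < 1
  /-- (i) one-step transport error, geometric in the level -/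
  size : ∀ k j, ‖(((Real.sqrt r : ℝ) : ℂ)) • (At k j - A j)‖ ≤ ν * θ ^ j
  /-- (ii) two-level consistency of the one-step families -/
  consistent : ∀ k, ∑ j ∈ Finset.range k, ‖(((Real.sqrt r : ℝ) : ℂ)) • (At (k + 1) j - At k j)‖ ≤ cs k

/-- `‖√r•At k j‖ ≤ 1 + νθ^j`. [folklore] -/
theorem opNorm_sqrt_smul_At_le (hr : 0 < r) (hA : ∀ j, ‖A j‖ ^ 2 ≤ r⁻¹) (hT : OneStepTransportLaws A At r ν θ cs) (k j : ℕ) :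
    ‖(((Real.sqrt r : ℝ) : ℂ)) • At k j‖ ≤ 1 + ν * θ ^ j := by
  have e : (((Real.sqrt r : ℝ) : ℂ)) • At k j = (((Real.sqrt r : ℝ) : ℂ)) • A j + (((Real.sqrt r : ℝ) : ℂ)) • (At k j - A j) := by
    rw [smul_sub, add_sub_cancel]
  rw [e]
  exact (norm_add_le _ _).trans (add_le_add (opNorm_normalised_le hr (hA j)) (hT.size k j))

/-- **`‖B̃^{(k)}_m‖ ≤ Pfac ν θ m`**. [folklore] -/
theorem opNorm_Btow_At_le (hr : 0 < r) (hA : ∀ j, ‖A j‖ ^ 2 ≤ r⁻¹) (hT : OneStepTransportLaws A At r ν θ cs) (k : ℕ) :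
    ∀ m, ‖Btow (At k) r m‖ ≤ Pfac ν θ m
  | 0 => by
    rw [Btow, pow_zero, Real.sqrt_one, Complex.ofReal_one, one_smul, Atow_zero]
    simpa [Pfac] using CovariantAveragingTower.opNorm_one_le (ι := ι) 0
  | m + 1 => by
    rw [Btow_succ' hr, Pfac_succ]
    exact (Matrix.l2_opNorm_mul _ _).trans (mul_le_mul (opNorm_Btow_At_le hr hA hT k m) (opNorm_sqrt_smul_At_le hr hA hT k m)
      (norm_nonneg _) (zero_le_one.trans (one_le_Pfac hT.nonneg.1 hT.nonneg.2.1 m)))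

/-- `‖B̃^{(k)}_m‖ ≤ bexp`. [folklore] -/
theorem opNorm_Btow_At_le_bexp (hr : 0 < r) (hA : ∀ j, ‖A j‖ ^ 2 ≤ r⁻¹) (hT : OneStepTransportLaws A At r ν θ cs) (k m : ℕ) :
    ‖Btow (At k) r m‖ ≤ bexp ν θ :=
  (opNorm_Btow_At_le hr hA hT k m).trans (Pfac_le_bexp hT.nonneg.1 hT.nonneg.2.1 hT.nonneg.2.2 m)

/-- **THE TRANSPORT ERROR OF THE COMPOSITE**: `‖B̃^{(k)}_m − B_m‖ ≤ bexp·ν·Σ_{j<m} θ^j`. [folklore] -/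
theorem opNorm_Etow_le (hr : 0 < r) (hA : ∀ j, ‖A j‖ ^ 2 ≤ r⁻¹) (hT : OneStepTransportLaws A At r ν θ cs) (k : ℕ) :
    ∀ m, ‖Btow (At k) r m - Btow A r m‖ ≤ bexp ν θ * (ν * ∑ j ∈ Finset.range m, θ ^ j)
  | 0 => by simp [Btow]
  | m + 1 => by
    have e : Btow (At k) r (m + 1) - Btow A r (m + 1)
        = (Btow (At k) r m - Btow A r m) * ((((Real.sqrt r : ℝ) : ℂ)) • A m)
          + Btow (At k) r m * ((((Real.sqrt r : ℝ) : ℂ)) • (At k m - A m)) := by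
      rw [Btow_succ' hr, Btow_succ' hr, smul_sub, Matrix.mul_sub, Matrix.sub_mul]; abel
    rw [e, Finset.sum_range_succ, mul_add, mul_add]
    refine (norm_add_le _ _).trans (add_le_add ?_ ?_)
    · exact (Matrix.l2_opNorm_mul _ _).trans ((mul_le_mul (opNorm_Etow_le hr hA hT k m) (opNorm_normalised_le hr (hA m))
        (norm_nonneg _) (by have := (bexp_pos ν θ).le; have := hT.nonneg.1; have := hT.nonneg.2.1; positivity)).trans
        (le_of_eq (mul_one _)))
    · exact (Matrix.l2_opNorm_mul _ _).trans (mul_le_mul (opNorm_Btow_At_le_bexp hr hA hT k m) (hT.size k m) (norm_nonneg _)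
        (bexp_pos ν θ).le)

/-- the composite transport error is at most `epsComp = bexp·ν/(1−θ)`, uniformly. [folklore] -/
def epsComp (ν θ : ℝ) : ℝ := bexp ν θ * (ν * (1 - θ)⁻¹)

/-- `‖B̃^{(k)}_m − B_m‖ ≤ epsComp`. [folklore] -/
theorem opNorm_Etow_le_eps (hr : 0 < r) (hA : ∀ j, ‖A j‖ ^ 2 ≤ r⁻¹) (hT : OneStepTransportLaws A At r ν θ cs) (k m : ℕ) :
    ‖Btow (At k) r m - Btow A r m‖ ≤ epsComp ν θ :=
  (opNorm_Etow_le hr hA hT k m).trans (mul_le_mul_of_nonneg_left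
    (mul_le_mul_of_nonneg_left (geom_partial_le hT.nonneg.2.1 hT.nonneg.2.2 m) hT.nonneg.1) (bexp_pos ν θ).le)

/-- **THE LEVEL-TO-LEVEL DIFFERENCE OF THE COMPOSITES** (weighted induction):
`‖B̃^{(k+1)}_m − B̃^{(k)}_m‖ ≤ Pfac_m · Σ_{j<m} ‖√r•(At (k+1) j − At k j)‖`. [folklore] -/
theorem opNorm_Dtow_le (hr : 0 < r) (hA : ∀ j, ‖A j‖ ^ 2 ≤ r⁻¹) (hT : OneStepTransportLaws A At r ν θ cs) (k : ℕ) :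
    ∀ m, ‖Btow (At (k + 1)) r m - Btow (At k) r m‖
      ≤ Pfac ν θ m * ∑ j ∈ Finset.range m, ‖(((Real.sqrt r : ℝ) : ℂ)) • (At (k + 1) j - At k j)‖
  | 0 => by simp [Btow]
  | m + 1 => by
    have hν := hT.nonneg.1
    have hθ := hT.nonneg.2.1
    set S := ∑ j ∈ Finset.range m, ‖(((Real.sqrt r : ℝ) : ℂ)) • (At (k + 1) j - At k j)‖ with hS
    set dm := ‖(((Real.sqrt r : ℝ) : ℂ)) • (At (k + 1) m - At k m)‖ with hdm
    have hS0 : 0 ≤ S := Finset.sum_nonneg fun _ _ => norm_nonneg _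
    have hP0 : 0 ≤ Pfac ν θ m := zero_le_one.trans (one_le_Pfac hν hθ m)
    have e : Btow (At (k + 1)) r (m + 1) - Btow (At k) r (m + 1)
        = (Btow (At (k + 1)) r m - Btow (At k) r m) * ((((Real.sqrt r : ℝ) : ℂ)) • At (k + 1) m)
          + Btow (At k) r m * ((((Real.sqrt r : ℝ) : ℂ)) • (At (k + 1) m - At k m)) := by
      rw [Btow_succ' hr, Btow_succ' hr, smul_sub, Matrix.mul_sub, Matrix.sub_mul]; abel
    rw [e, Finset.sum_range_succ]
    calc _ ≤ ‖(Btow (At (k + 1)) r m - Btow (At k) r m) * ((((Real.sqrt r : ℝ) : ℂ)) • At (k + 1) m)‖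
            + ‖Btow (At k) r m * ((((Real.sqrt r : ℝ) : ℂ)) • (At (k + 1) m - At k m))‖ := norm_add_le _ _
      _ ≤ (Pfac ν θ m * S) * (1 + ν * θ ^ m) + Pfac ν θ m * dm :=
          add_le_add ((Matrix.l2_opNorm_mul _ _).trans (mul_le_mul (opNorm_Dtow_le hr hA hT k m)
            (opNorm_sqrt_smul_At_le hr hA hT (k + 1) m) (norm_nonneg _) (mul_nonneg hP0 hS0)))
            ((Matrix.l2_opNorm_mul _ _).trans (mul_le_mul (opNorm_Btow_At_le hr hA hT k m) le_rfl (norm_nonneg _) hP0))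
      _ ≤ Pfac ν θ (m + 1) * (S + dm) := by
          rw [Pfac_succ]
          have hdm0 : 0 ≤ dm := norm_nonneg _
          have h1 : (1 : ℝ) ≤ 1 + ν * θ ^ m := le_add_of_nonneg_right (by positivity)
          nlinarith [mul_nonneg hP0 hdm0, mul_nonneg (mul_nonneg hP0 hdm0) (sub_nonneg.mpr h1)]

/-- at `m = k`: `‖B̃^{(k+1)}_k − B̃^{(k)}_k‖ ≤ bexp · cs k`. [folklore] -/
theorem opNorm_Dtow_le_cs (hr : 0 < r) (hA : ∀ j, ‖A j‖ ^ 2 ≤ r⁻¹) (hT : OneStepTransportLaws A At r ν θ cs) (k : ℕ) :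
    ‖Btow (At (k + 1)) r k - Btow (At k) r k‖ ≤ bexp ν θ * cs k :=
  (opNorm_Dtow_le hr hA hT k k).trans (mul_le_mul (Pfac_le_bexp hT.nonneg.1 hT.nonneg.2.1 hT.nonneg.2.2 k) (hT.consistent k)
    (Finset.sum_nonneg fun _ _ => norm_nonneg _) (bexp_pos ν θ).le)

end Composite

/-! ## §3 `AveragingLaws` for the composite transport error -/

section Laws

variable {ι : ℕ → Type*} [∀ k, Fintype (ι k)] [∀ k, DecidableEq (ι k)]
variable {D : (k : ℕ) → Matrix (ι k) (ι k) ℂ} {A : (j : ℕ) → Matrix (ι j) (ι (j + 1)) ℂ} {J : (k : ℕ) → Matrix (ι (k + 1)) (ι k) ℂ}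
  {F : (k : ℕ) → Matrix (ι k) (ι k) ℂ} {r : ℝ} {e₀ e₁ f₀ : ℕ → ℝ} {At : ℕ → (j : ℕ) → Matrix (ι j) (ι (j + 1)) ℂ} {ν θ γ' : ℝ}
  {cs : ℕ → ℝ}

/-- **THE COMPOSITE TRANSPORT ERROR** `E_k = B̃^{(k)}_k − B_k` (composite of the level-`k` one-step covariant averagings minus the free composite).
[folklore] -/
def Ecomp (A : (j : ℕ) → Matrix (ι j) (ι (j + 1)) ℂ) (At : ℕ → (j : ℕ) → Matrix (ι j) (ι (j + 1)) ℂ) (r : ℝ) (k : ℕ) :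
    Matrix (ι 0) (ι k) ℂ :=
  Btow (At k) r k - Btow A r k

/-- the sandwiched pairing defect of the composite: `(γ′ + f₀ k)·bexp·cs k + epsComp·f₀ k + bexp·γ′·ν·θ^k`. [folklore] -/
def deltaComp (γ' ν θ : ℝ) (f₀ cs : ℕ → ℝ) (k : ℕ) : ℝ :=
  (γ' + f₀ k) * (bexp ν θ * cs k) + epsComp ν θ * f₀ k + bexp ν θ * γ' * (ν * θ ^ k)

/-- **THE EXACT TWO-LEVEL IDENTITY OF THE COMPOSITE ERROR**: with `Δ = B̃^{(k+1)}_k − B̃^{(k)}_k`, `E = E_k`, `N = √r•(At (k+1) k − A k)`,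
`E_{k+1}J_k − E_k = Δ + (Δ + E)F_k + B̃^{(k+1)}_k·N·J_k`. [folklore] -/
theorem Ecomp_succ_mul_J_sub (hr : 0 < r) (hAJ : ∀ k, (((Real.sqrt r : ℝ) : ℂ)) • (A k * J k) = 1 + F k) (k : ℕ) :
    Ecomp A At r (k + 1) * J k - Ecomp A At r k
      = (Btow (At (k + 1)) r k - Btow (At k) r k)
        + ((Btow (At (k + 1)) r k - Btow (At k) r k) + Ecomp A At r k) * F k
        + Btow (At (k + 1)) r k * (((((Real.sqrt r : ℝ) : ℂ)) • (At (k + 1) k - A k)) * J k) := by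
  have hN : (((Real.sqrt r : ℝ) : ℂ)) • At (k + 1) k
      = (((Real.sqrt r : ℝ) : ℂ)) • A k + (((Real.sqrt r : ℝ) : ℂ)) • (At (k + 1) k - A k) := by rw [smul_sub, add_sub_cancel]
  have hAJ' : (((Real.sqrt r : ℝ) : ℂ)) • A k * J k = 1 + F k := by rw [Matrix.smul_mul]; exact hAJ k
  have h1 : Btow (At (k + 1)) r (k + 1) * J k
      = Btow (At (k + 1)) r k * (1 + F k) + Btow (At (k + 1)) r k * (((((Real.sqrt r : ℝ) : ℂ)) • (At (k + 1) k - A k)) * J k) := by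
    rw [Btow_succ' hr, Matrix.mul_assoc, hN, Matrix.add_mul, hAJ', Matrix.mul_add]
  have h2 : Btow A r (k + 1) * J k = Btow A r k * (1 + F k) := by
    rw [Btow_succ' hr, Matrix.mul_assoc, hAJ']
  rw [Ecomp, Ecomp, Matrix.sub_mul, h1, h2]
  simp only [Matrix.mul_add, Matrix.mul_one, Matrix.add_mul, Matrix.sub_mul]
  abel

/-- **`AveragingLaws` FOR THE COMPOSITE TRANSPORT ERROR**: free tower + `‖D_k⁻¹‖ ≤ γ′` + `OneStepTransportLaws` ⟹
`AveragingLaws D (Ecomp A At r) J (epsComp ν θ) (deltaComp γ′ ν θ f₀ cs)`. [folklore] -/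
theorem averagingLaws_composite (hr : 0 < r) (hfree : FreeTowerLaws D A J F r e₀ e₁ f₀) (hγ : ∀ k, ‖(D k)⁻¹‖ ≤ γ')
    (hT : OneStepTransportLaws A At r ν θ cs) : AveragingLaws D (Ecomp A At r) J (epsComp ν θ) (deltaComp γ' ν θ f₀ cs) where
  opNorm_le := fun k => opNorm_Etow_le_eps hr hfree.opNorm_A_sq_le hT k k
  pair_mul_inv_le := fun k => by
    have hγ0 : 0 ≤ γ' := (norm_nonneg _).trans (hγ 0)
    have hb := (bexp_pos ν θ).le
    have hΔ := opNorm_Dtow_le_cs hr hfree.opNorm_A_sq_le hT k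
    have hE := opNorm_Etow_le_eps hr hfree.opNorm_A_sq_le hT k k
    have hB := opNorm_Btow_At_le_bexp hr hfree.opNorm_A_sq_le hT (k + 1) k
    have hN := hT.size (k + 1) k
    have hcs : 0 ≤ bexp ν θ * cs k := (norm_nonneg _).trans hΔ
    have hε : 0 ≤ epsComp ν θ := (norm_nonneg _).trans hE
    have t1 : ‖(Btow (At (k + 1)) r k - Btow (At k) r k) * (D k)⁻¹‖ ≤ (bexp ν θ * cs k) * γ' :=
      (Matrix.l2_opNorm_mul _ _).trans (mul_le_mul hΔ (hγ k) (norm_nonneg _) hcs)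
    have t2 : ‖(Btow (At (k + 1)) r k - Btow (At k) r k + Ecomp A At r k) * F k * (D k)⁻¹‖
        ≤ (bexp ν θ * cs k + epsComp ν θ) * f₀ k := by
      rw [Matrix.mul_assoc]
      exact (Matrix.l2_opNorm_mul _ _).trans (mul_le_mul ((norm_add_le _ _).trans (add_le_add hΔ hE))
        (hfree.opNorm_F_mul_inv_le k) (norm_nonneg _) (add_nonneg hcs hε))
    have hNJ : ‖((((Real.sqrt r : ℝ) : ℂ)) • (At (k + 1) k - A k)) * J k‖ ≤ ν * θ ^ k :=
      (Matrix.l2_opNorm_mul _ _).trans ((mul_le_mul hN (hfree.opNorm_J_le k) (norm_nonneg _) ((norm_nonneg _).trans hN)).trans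
        (le_of_eq (mul_one _)))
    have t3 : ‖Btow (At (k + 1)) r k * (((((Real.sqrt r : ℝ) : ℂ)) • (At (k + 1) k - A k)) * J k) * (D k)⁻¹‖
        ≤ (bexp ν θ * (ν * θ ^ k)) * γ' :=
      (Matrix.l2_opNorm_mul _ _).trans (mul_le_mul ((Matrix.l2_opNorm_mul _ _).trans (mul_le_mul hB hNJ (norm_nonneg _) hb))
        (hγ k) (norm_nonneg _) (mul_nonneg hb ((norm_nonneg _).trans hN)))
    rw [Ecomp_succ_mul_J_sub hr hfree.A_mul_J k, Matrix.add_mul, Matrix.add_mul]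
    refine (norm_add_le _ _).trans ?_
    refine (add_le_add (norm_add_le _ _) le_rfl).trans ?_
    refine (add_le_add (add_le_add t1 t2) t3).trans (le_of_eq ?_)
    unfold deltaComp; ring
  inv_mul_pair_le := fun k => by
    have hγ0 : 0 ≤ γ' := (norm_nonneg _).trans (hγ 0)
    have hb := (bexp_pos ν θ).le
    have hΔ := opNorm_Dtow_le_cs hr hfree.opNorm_A_sq_le hT k
    have hE := opNorm_Etow_le_eps hr hfree.opNorm_A_sq_le hT k k
    have hB := opNorm_Btow_At_le_bexp hr hfree.opNorm_A_sq_le hT (k + 1) k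
    have hN := hT.size (k + 1) k
    have hf0 : 0 ≤ f₀ k := (norm_nonneg _).trans (hfree.opNorm_F_mul_inv_le k)
    have t1 : ‖(D k)⁻¹ * (Btow (At (k + 1)) r k - Btow (At k) r k)ᴴ‖ ≤ γ' * (bexp ν θ * cs k) := by
      refine (Matrix.l2_opNorm_mul _ _).trans (mul_le_mul (hγ k) ?_ (norm_nonneg _) hγ0)
      rw [Matrix.l2_opNorm_conjTranspose]; exact hΔ
    have t2 : ‖(D k)⁻¹ * ((Btow (At (k + 1)) r k - Btow (At k) r k + Ecomp A At r k) * F k)ᴴ‖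
        ≤ f₀ k * (bexp ν θ * cs k + epsComp ν θ) := by
      rw [Matrix.conjTranspose_mul, ← Matrix.mul_assoc]
      refine (Matrix.l2_opNorm_mul _ _).trans (mul_le_mul (hfree.opNorm_inv_mul_F_le k) ?_ (norm_nonneg _) hf0)
      rw [Matrix.l2_opNorm_conjTranspose]; exact (norm_add_le _ _).trans (add_le_add hΔ hE)
    have hNJ : ‖(((((Real.sqrt r : ℝ) : ℂ)) • (At (k + 1) k - A k)) * J k)ᴴ‖ ≤ ν * θ ^ k := by
      rw [Matrix.l2_opNorm_conjTranspose]
      exact (Matrix.l2_opNorm_mul _ _).trans ((mul_le_mul hN (hfree.opNorm_J_le k) (norm_nonneg _)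
        ((norm_nonneg _).trans hN)).trans (le_of_eq (mul_one _)))
    have t3 : ‖(D k)⁻¹ * (Btow (At (k + 1)) r k * (((((Real.sqrt r : ℝ) : ℂ)) • (At (k + 1) k - A k)) * J k))ᴴ‖
        ≤ (γ' * (ν * θ ^ k)) * bexp ν θ := by
      rw [Matrix.conjTranspose_mul, ← Matrix.mul_assoc]
      refine (Matrix.l2_opNorm_mul _ _).trans (mul_le_mul ((Matrix.l2_opNorm_mul _ _).trans
        (mul_le_mul (hγ k) hNJ (norm_nonneg _) hγ0)) ?_ (norm_nonneg _) (mul_nonneg hγ0 ((norm_nonneg _).trans hN)))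
      rw [Matrix.l2_opNorm_conjTranspose]; exact hB
    rw [Ecomp_succ_mul_J_sub hr hfree.A_mul_J k, Matrix.conjTranspose_add, Matrix.conjTranspose_add, Matrix.mul_add, Matrix.mul_add]
    refine (norm_add_le _ _).trans ?_
    refine (add_le_add (norm_add_le _ _) le_rfl).trans ?_
    refine (add_le_add (add_le_add t1 t2) t3).trans (le_of_eq ?_)
    unfold deltaComp; ring

/-! ## §4 With the Gram law: `PerturbationLaws` for `B̃ᴴB̃ − BᴴB` -/

/-- `B + E = B̃`: the Gram perturbation of the free composite by the composite error is `B̃ᴴB̃ − BᴴB`. [folklore] -/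
theorem gramCore_composite_eq (A : (j : ℕ) → Matrix (ι j) (ι (j + 1)) ℂ) (At : ℕ → (j : ℕ) → Matrix (ι j) (ι (j + 1)) ℂ) (r : ℝ)
    (k : ℕ) : gramCore (Btow A r) (Ecomp A At r) k = (Btow (At k) r k)ᴴ * Btow (At k) r k - (Btow A r k)ᴴ * Btow A r k := by
  rw [gramCore, Ecomp, add_sub_cancel]

/-- **`PerturbationLaws` FOR THE COVARIANT-AVERAGING SUMMAND OF A COMPOSITE TOWER**: free tower + `‖D_k⁻¹‖ ≤ γ′` + `OneStepTransportLaws` ⟹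
`PerturbationLaws D (k ↦ B̃ᴴB̃ − BᴴB) J (ε(2 + ε)γ′) (e2gram γ′ 1 ε e₀ e₁ f₀ (deltaComp …))`, `ε = epsComp ν θ`. [cite:
Balaban1985BackgroundPropagators, (3.15) p.393, (3.26) p.395 (shapes)] [folklore] -/
theorem perturbationLaws_compositeGram (hr : 0 < r) (hfree : FreeTowerLaws D A J F r e₀ e₁ f₀) (hγ : ∀ k, ‖(D k)⁻¹‖ ≤ γ')
    (hT : OneStepTransportLaws A At r ν θ cs) :
    PerturbationLaws D (gramCore (Btow A r) (Ecomp A At r)) J (epsComp ν θ * (2 * 1 + epsComp ν θ) * γ')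
      (e2gram γ' 1 (epsComp ν θ) e₀ e₁ f₀ (deltaComp γ' ν θ f₀ cs)) :=
  perturbationLaws_gramCore hfree hγ (averagingLaws_Btow hr hfree) (averagingLaws_composite hr hfree hγ hT)

end Laws

end Summit.QuantumFields.BalabanUV.T4Continuum.CompositeAveragingLaw

end
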